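import Mathlib.Topology.MetricSpace.Closeds
import Mathlib.Topology.Sets.VietorisTopology
import Mathlib.Topology.UniformSpace.Closeds
import Mathlib.Topology.Sequences
import Literature.Probability.Percolation.QuadCrossingNoiseDiscrete
import HarnessLib

/-!
# The quads crossed inside a closed plane set form a closed set; `ω_δ` without the closure

Topic `Probability/Percolation`; proofs file next to `QuadCrossingSpace.lean` /
`QuadCrossingSpaceZ2.lean`, proving the "Hausdorff-limit argument" those files record but do not
prove (module docstrings: "for the locally finite realisations of lattice configurations the raw
set is already closed — limits of crossings of `Qₙ → Q` inside a closed set are crossings of `Q`").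
It is needed by every comparison of the Schramm–Smirnov laws `μ_δ` with events of the discrete
configuration at FIXED quads — first of all by Schramm–Smirnov's Lemma 6.1
(`SchrammSmirnov2011_lemma_6_1`, file `QuadCrossingContinuity.lean`), whose events `⊞_Q`, `⊞_{Q'}`
must be read as "`ω` has an open crossing of `Q`" (O. Schramm, S. Smirnov, *On the scaling limits
of planar percolation*, Ann. Probab. 39 (2011), arXiv:1101.5820, §1.3: "`S_ω` … the set of all
quads for which `ω` contains a crossing formed by an open cluster").

* Hausdorff limits (generic metric-space lemmas): points of the limit are limits of points of the
  approximants and conversely (`exists_seq_mem_tendsto_of_hausdorffDist_tendsto`,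
  `mem_of_tendsto_of_hausdorffDist_tendsto`), and **a Hausdorff limit of connected sets is
  connected** (`isPreconnected_of_hausdorffDist_tendsto`).
* `Quad.isClosed_setOf_exists_isCrossing_subset` — **for a closed plane set `A`, the set of quads
  having a crossing inside `A` is closed in `𝒬_D`** (Blaschke selection — the subsets of a compact
  window form a compact set of nonempty compacta, Mathlib's
  `NonemptyCompacts.isCompact_subsets_of_isCompact` — then the limit continuum is a crossing of the
  limit quad).
* `isClosed_openEdgeUnion` — the drawn open edges of `δℤ²` (`δ > 0`) form a closed set (a locally
  finite union of segments), whence **`Q ∈ ω_δ ↔ Q` has a crossing inside the open edges**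
  (`mem_z2QuadConfig_iff_exists_isCrossing`, `coe_z2QuadConfig_eq`).

## References

* O. Schramm, S. Smirnov, Ann. Probab. 39 (2011) 1768–1814, arXiv:1101.5820, §1.3.
  [SchrammSmirnov2011]
-/

noncomputable section

open Set Filter Metric TopologicalSpace
open scoped Topology unitInterval

namespace Literature.Probability.Percolation

namespace QuadCrossing

/-! ### Hausdorff limits of compact sets in a metric space -/

section Hausdorff

variable {α : Type*} [MetricSpace α]

/-- If `hausdorffDist (K n) L → 0`, every point of `L` is the limit of a sequence of points
`y n ∈ K n`. [folklore] -/
theorem exists_seq_mem_tendsto_of_hausdorffDist_tendsto {K : ℕ → Set α} {L : Set α}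
    (hfin : ∀ n, hausdorffEDist (K n) L ≠ ⊤)
    (hH : Tendsto (fun n => hausdorffDist (K n) L) atTop (𝓝 0)) {x : α} (hx : x ∈ L) :
    ∃ y : ℕ → α, (∀ n, y n ∈ K n) ∧ Tendsto y atTop (𝓝 x) := by
  have hchoice : ∀ n, ∃ y ∈ K n, dist y x < hausdorffDist (K n) L + 1 / ((n : ℝ) + 1) := fun n =>
    exists_dist_lt_of_hausdorffDist_lt' hx (by linarith [Nat.one_div_pos_of_nat (α := ℝ) (n := n)])
      (hfin n)
  choose y hyK hyd using hchoice
  refine ⟨y, hyK, ?_⟩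
  rw [tendsto_iff_dist_tendsto_zero]
  have h0 : Tendsto (fun n : ℕ => hausdorffDist (K n) L + 1 / ((n : ℝ) + 1)) atTop (𝓝 0) := by
    simpa using hH.add tendsto_one_div_add_atTop_nhds_zero_nat
  exact squeeze_zero (fun n => dist_nonneg) (fun n => (hyd n).le) h0

/-- If `hausdorffDist (K n) L → 0`, `L` is closed and `y n ∈ K n` converge to `x`, then `x ∈ L`.
[folklore] -/
theorem mem_of_tendsto_of_hausdorffDist_tendsto {K : ℕ → Set α} {L : Set α} (hLc : IsClosed L)
    (hLne : L.Nonempty) (hfin : ∀ n, hausdorffEDist (K n) L ≠ ⊤)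
    (hH : Tendsto (fun n => hausdorffDist (K n) L) atTop (𝓝 0)) {y : ℕ → α} {x : α}
    (hy : ∀ n, y n ∈ K n) (hyx : Tendsto y atTop (𝓝 x)) : x ∈ L := by
  rw [hLc.mem_iff_infDist_zero hLne]
  have hle : ∀ n, infDist x L ≤ hausdorffDist (K n) L + dist x (y n) := fun n =>
    infDist_le_infDist_add_dist.trans
      (add_le_add (infDist_le_hausdorffDist_of_mem (hy n) (hfin n)) le_rfl)
  have hlim : Tendsto (fun n => hausdorffDist (K n) L + dist x (y n)) atTop (𝓝 0) := by
    have := hH.add (tendsto_iff_dist_tendsto_zero.1 hyx)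
    simpa [dist_comm] using this
  exact le_antisymm (ge_of_tendsto' hlim hle) infDist_nonneg

/-- **A Hausdorff limit of connected sets is connected.** If the `K n` are preconnected,
nonempty and bounded, `L` is compact, and `hausdorffDist (K n) L → 0`, then `L` is preconnected:
a separation `L = L₁ ⊔ L₂` into disjoint nonempty compacta would, for `n` large, place `K n` inside
the disjoint open thickenings of `L₁` and `L₂` while meeting both. [folklore] -/
theorem isPreconnected_of_hausdorffDist_tendsto {K : ℕ → Set α} {L : Set α} (hL : IsCompact L)
    (hK : ∀ n, IsPreconnected (K n)) (hfin : ∀ n, hausdorffEDist (K n) L ≠ ⊤)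
    (hH : Tendsto (fun n => hausdorffDist (K n) L) atTop (𝓝 0)) : IsPreconnected L := by
  rw [isPreconnected_iff_subset_of_disjoint_closed]
  intro u v hu hv hLuv hLuv'
  by_contra hcon
  push Not at hcon
  obtain ⟨hLu, hLv⟩ := hcon
  -- the two pieces
  set L₁ := L ∩ u with hL₁
  set L₂ := L ∩ v with hL₂
  have hL₁c : IsCompact L₁ := hL.inter_right hu
  have hL₂c : IsCompact L₂ := hL.inter_right hv
  have hdisj : Disjoint L₁ L₂ := by
    rw [Set.disjoint_iff]
    rintro x ⟨⟨hxL, hxu⟩, -, hxv⟩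
    have : x ∈ L ∩ (u ∩ v) := ⟨hxL, hxu, hxv⟩
    rw [hLuv'] at this
    exact this
  have hL₁ne : L₁.Nonempty := by
    obtain ⟨x, hxL, hxv⟩ := not_subset.1 hLv
    exact ⟨x, hxL, (hLuv hxL).resolve_right hxv⟩
  have hL₂ne : L₂.Nonempty := by
    obtain ⟨x, hxL, hxu⟩ := not_subset.1 hLu
    exact ⟨x, hxL, (hLuv hxL).resolve_left hxu⟩
  have hLeq : L = L₁ ∪ L₂ := by
    refine Subset.antisymm (fun x hx => ?_) (union_subset inter_subset_left inter_subset_left)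
    rcases hLuv hx with h | h
    · exact Or.inl ⟨hx, h⟩
    · exact Or.inr ⟨hx, h⟩
  obtain ⟨ε, hε, hthick⟩ := hdisj.exists_thickenings hL₁c hL₂c.isClosed
  -- for `n` large, `hausdorffDist (K n) L < ε`
  obtain ⟨n, hn⟩ := (Metric.tendsto_nhds.1 hH ε hε).exists
  rw [Real.dist_eq, sub_zero, abs_of_nonneg hausdorffDist_nonneg] at hn
  have hLne : L.Nonempty := hL₁ne.mono inter_subset_left
  -- `K n` lies in the union of the two open thickenings
  have hKsub : K n ⊆ thickening ε L₁ ∪ thickening ε L₂ := fun y hy => by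
    rw [← thickening_union, ← hLeq, mem_thickening_iff_infDist_lt hLne]
    exact (infDist_le_hausdorffDist_of_mem hy (hfin n)).trans_lt hn
  -- and meets both
  have hmeet : ∀ {M : Set α}, M ⊆ L → M.Nonempty → (K n ∩ thickening ε M).Nonempty := by
    intro M hML hMne
    obtain ⟨x, hx⟩ := hMne
    obtain ⟨y, hy, hyx⟩ := exists_dist_lt_of_hausdorffDist_lt' (hML hx) hn (hfin n)
    exact ⟨y, hy, mem_thickening_iff.2 ⟨x, hx, hyx⟩⟩
  obtain ⟨z, -, hz₁, hz₂⟩ := hK n _ _ isOpen_thickening isOpen_thickening hKsub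
    (hmeet inter_subset_left hL₁ne) (hmeet inter_subset_left hL₂ne)
  exact Set.disjoint_left.1 hthick hz₁ hz₂

-- Blaschke's selection theorem (the nonempty compact subsets of a compact set form a compact
-- subset of the Hausdorff space) is Mathlib's
-- `TopologicalSpace.NonemptyCompacts.isCompact_subsets_of_isCompact` (Vietoris topology =
-- Hausdorff-metric topology on `NonemptyCompacts`); it is used directly below.

end Hausdorff

/-! ### Crossed quads of a closed drawing form a closed set of quads -/

namespace Quad

variable {D : Set ℂ}

/-- Points `Qₙ(zₙ)` with `Qₙ → Q` uniformly have their limits in `[Q]`: if `Qₙ(zₙ) → x` along a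
sequence of quads converging to `Q`, then `x ∈ [Q]`. [folklore] -/
theorem mem_carrier_of_tendsto {Qs : ℕ → Quad D} {Q : Quad D} (hQ : Tendsto Qs atTop (𝓝 Q))
    {z : ℕ → I × I} {x : ℂ} (hx : Tendsto (fun n => Qs n (z n)) atTop (𝓝 x)) :
    x ∈ Q.carrier := by
  obtain ⟨w, -, φ, hφ, hw⟩ := (isCompact_univ (X := I × I)).tendsto_subseq (fun n => mem_univ (z n))
  have h1 : Tendsto (fun n => Qs (φ n) (z (φ n))) atTop (𝓝 x) := hx.comp hφ.tendsto_atTop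
  have h2 : Tendsto (fun n => Qs (φ n) (z (φ n))) atTop (𝓝 (Q w)) := by
    rw [tendsto_iff_dist_tendsto_zero]
    have hb : ∀ n, dist (Qs (φ n) (z (φ n))) (Q w) ≤
        dist (Qs (φ n)) Q + dist (Q (z (φ n))) (Q w) := fun n =>
      (dist_triangle _ (Q (z (φ n))) _).trans
        (add_le_add (Quad.dist_apply_le (Qs (φ n)) Q (z (φ n))) le_rfl)
    have hl : Tendsto (fun n => dist (Qs (φ n)) Q + dist (Q (z (φ n))) (Q w)) atTop (𝓝 0) := by
      have ha : Tendsto (fun n => dist (Qs (φ n)) Q) atTop (𝓝 0) :=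
        (tendsto_iff_dist_tendsto_zero.1 hQ).comp hφ.tendsto_atTop
      have hb' : Tendsto (fun n => dist (Q (z (φ n))) (Q w)) atTop (𝓝 0) :=
        tendsto_iff_dist_tendsto_zero.1 ((Q.continuous_toFun.tendsto w).comp hw)
      simpa using ha.add hb'
    exact squeeze_zero (fun n => dist_nonneg) hb hl
  rw [tendsto_nhds_unique h1 h2]
  exact ⟨w, rfl⟩

/-- The four closed edges of the square, as the index sets of the sides. [folklore] -/
theorem side_eq_image (Q : Quad D) (k : Fin 4) : ∃ E : Set (I × I), IsClosed E ∧ Q.side k = Q '' E ∧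
    ∀ Q' : Quad D, Q'.side k = Q' '' E := by
  match k with
  | 0 => exact ⟨{z | z.1 = 0}, isClosed_eq continuous_fst continuous_const, rfl, fun _ => rfl⟩
  | 1 => exact ⟨{z | z.2 = 0}, isClosed_eq continuous_snd continuous_const, rfl, fun _ => rfl⟩
  | 2 => exact ⟨{z | z.1 = 1}, isClosed_eq continuous_fst continuous_const, rfl, fun _ => rfl⟩
  | 3 => exact ⟨{z | z.2 = 1}, isClosed_eq continuous_snd continuous_const, rfl, fun _ => rfl⟩

/-- Side points `yₙ ∈ ∂ₖQₙ` with `Qₙ → Q` accumulate on `∂ₖQ`: some subsequence of `yₙ` converges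
to a point of `∂ₖQ`. [folklore] -/
theorem exists_subseq_tendsto_mem_side {Qs : ℕ → Quad D} {Q : Quad D}
    (hQ : Tendsto Qs atTop (𝓝 Q)) (k : Fin 4) {y : ℕ → ℂ} (hy : ∀ n, y n ∈ (Qs n).side k) :
    ∃ x ∈ Q.side k, ∃ φ : ℕ → ℕ, StrictMono φ ∧ Tendsto (y ∘ φ) atTop (𝓝 x) := by
  obtain ⟨E, hE, hQE, hall⟩ := Q.side_eq_image k
  have hz : ∀ n, ∃ z ∈ E, Qs n z = y n := fun n => by
    have := hy n
    rw [hall (Qs n)] at this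
    exact this
  choose z hzE hzy using hz
  obtain ⟨w, hwE, φ, hφ, hw⟩ := hE.isCompact.tendsto_subseq hzE
  refine ⟨Q w, hQE ▸ ⟨w, hwE, rfl⟩, φ, hφ, ?_⟩
  have : (y ∘ φ) = fun n => Qs (φ n) (z (φ n)) := funext fun n => (hzy (φ n)).symm
  rw [this, tendsto_iff_dist_tendsto_zero]
  have hb : ∀ n, dist (Qs (φ n) (z (φ n))) (Q w) ≤
      dist (Qs (φ n)) Q + dist (Q (z (φ n))) (Q w) := fun n =>
    (dist_triangle _ (Q (z (φ n))) _).trans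
      (add_le_add (Quad.dist_apply_le (Qs (φ n)) Q (z (φ n))) le_rfl)
  have hl : Tendsto (fun n => dist (Qs (φ n)) Q + dist (Q (z (φ n))) (Q w)) atTop (𝓝 0) := by
    have ha : Tendsto (fun n => dist (Qs (φ n)) Q) atTop (𝓝 0) :=
      (tendsto_iff_dist_tendsto_zero.1 hQ).comp hφ.tendsto_atTop
    have hb' : Tendsto (fun n => dist (Q (z (φ n))) (Q w)) atTop (𝓝 0) :=
      tendsto_iff_dist_tendsto_zero.1 ((Q.continuous_toFun.tendsto w).comp hw)
    simpa using ha.add hb'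
  exact squeeze_zero (fun n => dist_nonneg) hb hl

/-- **The quads crossed inside a closed plane set form a closed subset of `𝒬_D`.**  If `Qₙ → Q`
uniformly and each `Qₙ` has a crossing `Kₙ ⊆ A` (`A` closed), then a Hausdorff-convergent
subsequence of the continua `Kₙ` (Blaschke) has a limit `K ⊆ A ∩ [Q]` that is compact, connected
and meets `∂₀Q` and `∂₂Q`, i.e. a crossing of `Q`.  This is the closedness of Schramm–Smirnov's raw
configuration `S_ω` for closed realisations of `ω`. [cite: SchrammSmirnov2011, §1.3] -/
theorem isClosed_setOf_exists_isCrossing_subset {A : Set ℂ} (hA : IsClosed A) :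
    IsClosed {Q : Quad D | ∃ K, Q.IsCrossing K ∧ K ⊆ A} := by
  refine IsSeqClosed.isClosed fun Qs Q hQs hlim => ?_
  choose K hK hKA using hQs
  -- a compact window containing all the `K n`
  obtain ⟨R, hR⟩ : ∃ R, ∀ n, dist (Qs n) Q ≤ R := by
    obtain ⟨R, hR⟩ := Metric.isBounded_range_iff.1 (isBounded_range_of_tendsto Qs hlim)
    exact ⟨R + dist (Qs 0) Q, fun n =>
      (dist_triangle (Qs n) (Qs 0) Q).trans (add_le_add (hR n 0) le_rfl)⟩
  set C := cthickening R Q.carrier with hC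
  have hCc : IsCompact C := Q.isCompact_carrier.cthickening
  have hKC : ∀ n, K n ⊆ C := fun n x hx =>
    (Quad.carrier_subset_cthickening_of_dist_le (hR n)) ((hK n).2.2.1 hx)
  -- the `K n` as nonempty compacta
  have hKne : ∀ n, (K n).Nonempty := fun n => ((hK n).2.2.2.1).mono inter_subset_left
  let Kc : ℕ → NonemptyCompacts ℂ := fun n => ⟨⟨K n, (hK n).1⟩, hKne n⟩
  have hKc : ∀ n, (Kc n : Set ℂ) = K n := fun n => rfl
  obtain ⟨L, hLC, φ, hφ, hconv⟩ :=
    (NonemptyCompacts.isCompact_subsets_of_isCompact hCc).tendsto_subseq (x := Kc) (fun n => hKC n)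
  -- Hausdorff convergence along the subsequence
  have hH : Tendsto (fun n => hausdorffDist (K (φ n)) (L : Set ℂ)) atTop (𝓝 0) := by
    have := tendsto_iff_dist_tendsto_zero.1 hconv
    simpa [Function.comp, NonemptyCompacts.dist_eq, hKc] using this
  have hfin : ∀ n, hausdorffEDist (K (φ n)) (L : Set ℂ) ≠ ⊤ := fun n =>
    hausdorffEDist_ne_top_of_nonempty_of_bounded (hKne _) L.nonempty (hK _).1.isBounded
      L.isCompact.isBounded
  have hlim' : Tendsto (Qs ∘ φ) atTop (𝓝 Q) := hlim.comp hφ.tendsto_atTop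
  refine ⟨L, ⟨L.isCompact, ⟨L.nonempty, ?_⟩, ?_, ?_, ?_⟩, ?_⟩
  · -- connected
    exact isPreconnected_of_hausdorffDist_tendsto L.isCompact (fun n => (hK (φ n)).2.1.2) hfin hH
  · -- inside `[Q]`
    intro x hx
    obtain ⟨y, hy, hyx⟩ := exists_seq_mem_tendsto_of_hausdorffDist_tendsto hfin hH hx
    have hy' : ∀ n, ∃ z : I × I, Qs (φ n) z = y n := fun n => (hK (φ n)).2.2.1 (hy n)
    choose z hz using hy'
    have : (fun n => (Qs ∘ φ) n (z n)) = y := funext hz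
    exact mem_carrier_of_tendsto hlim' (by rw [this]; exact hyx)
  · -- meets `∂₀Q`
    have hy : ∀ n, ∃ y, y ∈ K (φ n) ∧ y ∈ (Qs (φ n)).side 0 := fun n => (hK (φ n)).2.2.2.1
    choose y hyK hyS using hy
    obtain ⟨x, hx, ψ, hψ, hconv'⟩ := exists_subseq_tendsto_mem_side hlim' 0 hyS
    refine ⟨x, ?_, hx⟩
    exact mem_of_tendsto_of_hausdorffDist_tendsto L.isCompact.isClosed L.nonempty
      (fun n => hfin (ψ n)) (hH.comp hψ.tendsto_atTop) (fun n => hyK (ψ n)) hconv'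
  · -- meets `∂₂Q`
    have hy : ∀ n, ∃ y, y ∈ K (φ n) ∧ y ∈ (Qs (φ n)).side 2 := fun n => (hK (φ n)).2.2.2.2
    choose y hyK hyS using hy
    obtain ⟨x, hx, ψ, hψ, hconv'⟩ := exists_subseq_tendsto_mem_side hlim' 2 hyS
    refine ⟨x, ?_, hx⟩
    exact mem_of_tendsto_of_hausdorffDist_tendsto L.isCompact.isClosed L.nonempty
      (fun n => hfin (ψ n)) (hH.comp hψ.tendsto_atTop) (fun n => hyK (ψ n)) hconv'
  · -- inside `A`
    intro x hx
    obtain ⟨y, hy, hyx⟩ := exists_seq_mem_tendsto_of_hausdorffDist_tendsto hfin hH hx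
    exact hA.mem_of_tendsto hyx (Eventually.of_forall fun n => hKA _ (hy n))

end Quad

/-! ### The drawn open edges form a closed set; `ω_δ` is the raw crossed set -/

open LatticeModels

/-- **The drawn open edges `openEdgeUnion δ ω` form a closed plane set** (`δ > 0`): a locally
finite union of closed segments (only the finitely many edges with both endpoints within `δ` of a
bounded window are drawn through it, `meshVertices_finite`). [folklore] -/
theorem isClosed_openEdgeUnion {δ : ℝ} (hδ : 0 < δ) (ω : BondConfig (Site 2)) :
    IsClosed (openEdgeUnion δ ω) := by
  -- the family of drawn segments, indexed by ordered pairs of sites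
  let S : Site 2 × Site 2 → Set ℂ := fun p =>
    {z | (zdGraph 2).Adj p.1 p.2 ∧ s(p.1, p.2) ∈ ω ∧ z ∈ segment ℝ (meshPoint δ p.1) (meshPoint δ p.2)}
  have hS : openEdgeUnion δ ω = ⋃ p, S p := by
    ext z
    simp only [mem_openEdgeUnion_iff, mem_iUnion, mem_setOf_eq, S, Prod.exists]
  have hSc : ∀ p, IsClosed (S p) := fun p => by
    by_cases h : (zdGraph 2).Adj p.1 p.2 ∧ s(p.1, p.2) ∈ ω
    · have : S p = segment ℝ (meshPoint δ p.1) (meshPoint δ p.2) := by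
        ext z
        simp only [S, mem_setOf_eq]
        exact ⟨fun hz => hz.2.2, fun hz => ⟨h.1, h.2, hz⟩⟩
      rw [this, ← convexHull_pair (𝕜 := ℝ)]
      exact (Set.toFinite _).isClosed_convexHull ℝ
    · have : S p = ∅ := by
        ext z
        simp only [S, mem_setOf_eq, mem_empty_iff_false, iff_false, not_and]
        exact fun h1 h2 _ => h ⟨h1, h2⟩
      rw [this]
      exact isClosed_empty
  have hlf : LocallyFinite S := fun z => by
    refine ⟨ball z 1, ball_mem_nhds z one_pos, ?_⟩
    set V : Set (Site 2) := meshVertices (cthickening δ (ball z 1)) δ with hV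
    have hVfin : V.Finite := meshVertices_finite isBounded_ball.cthickening hδ
    refine (hVfin.prod hVfin).subset ?_
    rintro ⟨x, y⟩ ⟨w, ⟨hxy, -, hws⟩, hwz⟩
    have hmem : ∀ x' y' : Site 2, (zdGraph 2).Adj x' y' →
        w ∈ segment ℝ (meshPoint δ x') (meshPoint δ y') → x' ∈ V := fun x' y' hxy' hws' => by
      rw [hV, mem_meshVertices_iff]
      refine mem_cthickening_of_dist_le _ w _ _ hwz ?_
      rw [dist_comm, dist_eq_norm]
      exact (norm_sub_le_of_mem_segment hws').trans
        ((norm_meshPoint_sub_meshPoint_le_of_adj δ hxy').trans (abs_of_pos hδ).le)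
    exact ⟨hmem x y hxy hws, hmem y x hxy.symm (by rwa [segment_symm])⟩
  rw [hS]
  exact hlf.isClosed_iUnion hSc

variable {D : Set ℂ}

/-- **`ω_δ` is the raw crossed set** (`δ > 0`): the set of quads having a crossing inside the drawn
open edges is already closed, so the closure in the definition of `z2QuadConfig` is not needed.
[cite: SchrammSmirnov2011, §1.3] -/
theorem coe_z2QuadConfig_eq {δ : ℝ} (hδ : 0 < δ) (ω : BondConfig (Site 2)) :
    (z2QuadConfig D δ ω : Set (Quad D)) = {Q | ∃ K, Q.IsCrossing K ∧ K ⊆ openEdgeUnion δ ω} := by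
  rw [coe_z2QuadConfig]
  exact (Quad.isClosed_setOf_exists_isCrossing_subset (isClosed_openEdgeUnion hδ ω)).closure_eq

/-- **`Q ∈ ω_δ ↔ Q` has a crossing inside the drawn open edges of `ω`** (`δ > 0`).
[cite: SchrammSmirnov2011, §1.3] -/
theorem mem_z2QuadConfig_iff_exists_isCrossing {δ : ℝ} (hδ : 0 < δ) {ω : BondConfig (Site 2)}
    {Q : Quad D} : Q ∈ z2QuadConfig D δ ω ↔ ∃ K, Q.IsCrossing K ∧ K ⊆ openEdgeUnion δ ω := by
  rw [← QuadConfig.mem_coe, coe_z2QuadConfig_eq hδ]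
  rfl

end QuadCrossing

end Literature.Probability.Percolation
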